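import Summits.Ventures.PercRepro.C026StarPrime

/-!
# The residual `KL` of C-026: structure and Lemma E (closure under opening the star at `c`) (p5, gen 7)

mine-3's `proofs/MINE3-Q3-proof.md` §4 / §11 S2 on the residual `KL = BotM ∧ ¬O1 ∧ ¬O2`:

* **`o1_or_o2_of_hConn_of_mem`** — an H-walk from `c` to a vertex of `K ∪ L` gives an offer (split at the
  first vertex of `K ∪ L`); hence for `S ∈ KL`: `c ≁_H a`, `c ≁_H b` (`not_hConn_c_a_of_kl`) and **no edge
  of `G` joins `c` to `K ∪ L`** (`not_mem_edgesAt_c_of_mem_edgesAt_cluster_a`);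
* `openAt c ω` — the configuration with every edge at `c` opened; its `c`-cluster
  (`mem_cluster_openAt_c_iff`: `M` and the clusters of the neighbours of `c`); the clusters of `a`, `b`
  are unchanged (`cluster_openAt_a_eq`), so `S⁺ ∈ bot` (`isBot_openAt`);
* the transfer of H-steps avoiding the H-component of `c` (`hAdj_openAt_of_hAdj`, `hConn_openAt_of_hConn`):
  `S⁺ ∈ BAD`; no H-step of `S⁺` leaves `c` (`not_hAdj_openAt_c`), so `S⁺` has no offer;
* **LEMMA E `kl_openAt`**: `KL S → KL (S ∪ E_c)`.
-/

namespace PercRepro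

namespace MultiGraph

section Residual

variable {V E : Type*} (G : MultiGraph V E)

/-- An H-walk from `c` ending in `K ∪ L` gives an offer: `c ~_H a` avoiding `L`, or `c ~_H b` avoiding `K`
(split at the first vertex of `K ∪ L`). -/
theorem o1_or_o2_of_hConn_of_mem {S : Config E} {a b c : V} (h : G.IsBot S a b c) {v : V}
    (hv : v ∈ G.cluster S a ∨ v ∈ G.cluster S b) (hw : G.HConn S c c v) :
    G.HConnAvoid S c (G.cluster S b) c a ∨ G.HConnAvoid S c (G.cluster S a) c b := by
  have haM : a ∉ G.cluster S c := fun ha => h.2.1 (ha : G.Conn S c a).symm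
  have hbM : b ∉ G.cluster S c := fun hb => h.2.2 (hb : G.Conn S c b).symm
  have hcK : c ∉ G.cluster S a := fun hc => h.2.1 hc
  have hcL : c ∉ G.cluster S b := fun hc => h.2.2 hc
  have haL : a ∉ G.cluster S b := fun ha => h.1 (ha : G.Conn S b a).symm
  have hbK : b ∉ G.cluster S a := fun hb => h.1 hb
  -- a vertex of `K` reaches `a` inside `K` avoiding `L`; a vertex of `L` reaches `b` avoiding `K`
  have stepK : ∀ x ∈ G.cluster S a, G.HConnAvoid S c (G.cluster S b) x a := by
    intro x hx
    have hxM : x ∉ G.cluster S c := fun hxM => h.2.1 ((hx : G.Conn S a x).trans (hxM : G.Conn S c x).symm)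
    have hxL : x ∉ G.cluster S b := fun hxL => h.1 ((hx : G.Conn S a x).trans (hxL : G.Conn S b x).symm)
    exact Relation.ReflTransGen.single
      ⟨Or.inr (Or.inr ⟨hxM, haM, (hx : G.Conn S a x).symm⟩), hxL, haL⟩
  have stepL : ∀ x ∈ G.cluster S b, G.HConnAvoid S c (G.cluster S a) x b := by
    intro x hx
    have hxM : x ∉ G.cluster S c := fun hxM => h.2.2 ((hx : G.Conn S b x).trans (hxM : G.Conn S c x).symm)
    have hxK : x ∉ G.cluster S a := fun hxK => h.1 ((hxK : G.Conn S a x).trans (hx : G.Conn S b x).symm)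
    exact Relation.ReflTransGen.single
      ⟨Or.inr (Or.inr ⟨hxM, hbM, (hx : G.Conn S b x).symm⟩), hxK, hbK⟩
  -- induction from the end of the walk
  unfold HConn at hw
  suffices key : ∀ x, Relation.ReflTransGen (G.HAdj S c) x v →
      G.HConnAvoid S c (G.cluster S b) x a ∨ G.HConnAvoid S c (G.cluster S a) x b from key c hw
  intro x hxv
  induction hxv using Relation.ReflTransGen.head_induction_on with
  | refl =>
    rcases hv with hv | hv
    · exact Or.inl (stepK v hv)
    · exact Or.inr (stepL v hv)
  | @head x y hxy _ ih =>
    by_cases hxK : x ∈ G.cluster S a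
    · exact Or.inl (stepK x hxK)
    by_cases hxL : x ∈ G.cluster S b
    · exact Or.inr (stepL x hxL)
    by_cases hyK : y ∈ G.cluster S a
    · have hyL : y ∉ G.cluster S b :=
        fun hyL => h.1 ((hyK : G.Conn S a y).trans (hyL : G.Conn S b y).symm)
      exact Or.inl (Relation.ReflTransGen.head ⟨hxy, hxL, hyL⟩ (stepK y hyK))
    by_cases hyL : y ∈ G.cluster S b
    · exact Or.inr (Relation.ReflTransGen.head ⟨hxy, hxK, hyK⟩ (stepL y hyL))
    rcases ih with h1 | h1
    · exact Or.inl (Relation.ReflTransGen.head ⟨hxy, hxL, hyL⟩ h1)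
    · exact Or.inr (Relation.ReflTransGen.head ⟨hxy, hxK, hyK⟩ h1)

/-- For `S ∈ KL`, `c` reaches no vertex of `K ∪ L` in the H-graph. -/
theorem not_hConn_c_of_kl {S : Config E} {a b c : V} (h : G.KL S a b c) {v : V}
    (hv : v ∈ G.cluster S a ∨ v ∈ G.cluster S b) : ¬ G.HConn S c c v := by
  intro hw
  rcases G.o1_or_o2_of_hConn_of_mem h.1.1 hv hw with h1 | h1
  · exact h.2.1 ⟨h.1.1, (G.cellAC_kSwapSealed_iff h.1.1).mpr h1⟩
  · exact h.2.2 ⟨h.1.1, (G.cellBC_kSwapSealed_iff h.1.1).mpr h1⟩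

/-- For `S ∈ KL`, `c ≁_H a`. -/
theorem not_hConn_c_a_of_kl {S : Config E} {a b c : V} (h : G.KL S a b c) : ¬ G.HConn S c c a :=
  G.not_hConn_c_of_kl h (Or.inl (G.self_mem_cluster S a))

/-- For `S ∈ KL`, no edge of `G` joins `c` to a vertex of `K ∪ L`. -/
theorem not_joins_c_of_kl {S : Config E} {a b c : V} (h : G.KL S a b c) {e : E} {v : V}
    (hj : G.Joins e c v) (hv : v ∈ G.cluster S a ∨ v ∈ G.cluster S b) : False := by
  have hvM : v ∉ G.cluster S c := by
    rcases hv with hv | hv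
    · exact fun hvM => h.1.1.2.1 ((hv : G.Conn S a v).trans (hvM : G.Conn S c v).symm)
    · exact fun hvM => h.1.1.2.2 ((hv : G.Conn S b v).trans (hvM : G.Conn S c v).symm)
  have hcM : c ∈ G.cluster S c := G.self_mem_cluster S c
  have hadj : G.HAdj S c c v := Or.inr (Or.inl ⟨⟨fun _ => hvM, fun _ => hcM⟩, e, hj⟩)
  exact G.not_hConn_c_of_kl h hv (Relation.ReflTransGen.single hadj)

/-- For `S ∈ KL`, an edge at `K` is not at `c`. -/
theorem not_mem_edgesAt_c_of_mem_edgesAt_cluster_a {S : Config E} {a b c : V} (h : G.KL S a b c)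
    {e : E} (he : e ∈ G.edgesAt (G.cluster S a)) : e ∉ G.edgesAt ({c} : Set V) := by
  intro hc
  simp only [edgesAt, Set.mem_setOf_eq, Set.mem_singleton_iff] at hc
  rcases hc with hc | hc <;> rcases he with he | he
  · exact h.1.1.2.1 (hc ▸ he)
  · exact G.not_joins_c_of_kl h (Or.inl ⟨hc, rfl⟩) (Or.inl he)
  · exact G.not_joins_c_of_kl h (Or.inr ⟨rfl, hc⟩) (Or.inl he)
  · exact h.1.1.2.1 (hc ▸ he)

/-- For `S ∈ KL`, an edge at `L` is not at `c`. -/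
theorem not_mem_edgesAt_c_of_mem_edgesAt_cluster_b {S : Config E} {a b c : V} (h : G.KL S a b c)
    {e : E} (he : e ∈ G.edgesAt (G.cluster S b)) : e ∉ G.edgesAt ({c} : Set V) := by
  intro hc
  simp only [edgesAt, Set.mem_setOf_eq, Set.mem_singleton_iff] at hc
  rcases hc with hc | hc <;> rcases he with he | he
  · exact h.1.1.2.2 (hc ▸ he)
  · exact G.not_joins_c_of_kl h (Or.inl ⟨hc, rfl⟩) (Or.inr he)
  · exact G.not_joins_c_of_kl h (Or.inr ⟨rfl, hc⟩) (Or.inr he)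
  · exact h.1.1.2.2 (hc ▸ he)

/-! ### Opening the star at `c` -/

open Classical in
/-- `S ∪ E_c`: every edge at `c` opened. -/
noncomputable def openAt (c : V) (ω : Config E) : Config E :=
  fun e => if e ∈ G.edgesAt ({c} : Set V) then true else ω e

/-- `openAt` on an edge at `c`. -/
theorem openAt_apply_of_mem {c : V} {ω : Config E} {e : E} (he : e ∈ G.edgesAt ({c} : Set V)) :
    G.openAt c ω e = true := by
  simp [openAt, he]

/-- `openAt` away from `c`. -/
theorem openAt_apply_of_notMem {c : V} {ω : Config E} {e : E} (he : e ∉ G.edgesAt ({c} : Set V)) :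
    G.openAt c ω e = ω e := by
  simp [openAt, he]

/-- `ω ≤ openAt c ω`. -/
theorem le_openAt (c : V) (ω : Config E) : ω ≤ G.openAt c ω := by
  intro e
  by_cases he : e ∈ G.edgesAt ({c} : Set V)
  · rw [G.openAt_apply_of_mem he]
    exact Bool.le_true _
  · rw [G.openAt_apply_of_notMem he]

/-- An edge joining `c` and `x` is at `c`. -/
theorem mem_edgesAt_c_of_joins {c x : V} {e : E} (hj : G.Joins e c x) : e ∈ G.edgesAt ({c} : Set V) := by
  rcases hj with ⟨h1, _⟩ | ⟨_, h2⟩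
  · exact Or.inl (by rw [h1]; rfl)
  · exact Or.inr (by rw [h2]; rfl)

/-- **The `c`-cluster of `S ∪ E_c`**: `M` together with the `S`-clusters of the neighbours of `c`. -/
theorem mem_cluster_openAt_c_iff (c : V) (ω : Config E) (v : V) :
    v ∈ G.cluster (G.openAt c ω) c ↔
      G.Conn ω c v ∨ ∃ x, (∃ e, G.Joins e c x) ∧ G.Conn ω x v := by
  constructor
  · intro hv
    refine Conn.induction (motive := fun w => G.Conn ω c w ∨ ∃ x, (∃ e, G.Joins e c x) ∧ G.Conn ω x w)
      (Or.inl (Conn.refl G ω c)) ?_ hv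
    intro u w _ huw ih
    obtain ⟨e, he, hend⟩ := huw
    by_cases hec : e ∈ G.edgesAt ({c} : Set V)
    · -- an edge at `c`: `w` is `c` or a neighbour of `c`
      simp only [edgesAt, Set.mem_setOf_eq, Set.mem_singleton_iff] at hec
      rcases hec with hec | hec <;> rcases hend with ⟨h1, h2⟩ | ⟨h1, h2⟩
      · exact Or.inr ⟨w, ⟨e, Or.inl ⟨hec, h2⟩⟩, Conn.refl G ω w⟩
      · exact Or.inl (by rw [← h1, hec]; exact Conn.refl G ω c)
      · exact Or.inl (by rw [← h2, hec]; exact Conn.refl G ω c)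
      · exact Or.inr ⟨w, ⟨e, Or.inr ⟨h1, hec⟩⟩, Conn.refl G ω w⟩
    · -- an edge away from `c`: open in `ω`
      have hωe : ω e = true := by rwa [G.openAt_apply_of_notMem hec] at he
      have hstep : G.Conn ω u w := Conn.of_openAdj ⟨e, hωe, hend⟩
      rcases ih with ih | ⟨x, hx, hxu⟩
      · exact Or.inl (ih.trans hstep)
      · exact Or.inr ⟨x, hx, hxu.trans hstep⟩
  · rintro (hv | ⟨x, ⟨e, hj⟩, hxv⟩)
    · exact Conn.mono (G.le_openAt c ω) hv
    · have h1 : G.Conn (G.openAt c ω) c x :=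
        Conn.of_openAdj ⟨e, G.openAt_apply_of_mem (G.mem_edgesAt_c_of_joins hj), hj⟩
      exact h1.trans (Conn.mono (G.le_openAt c ω) hxv)

/-- A vertex outside `M` that is not H-reachable from `c` is outside the `c`-cluster of `S ∪ E_c`. -/
theorem not_mem_cluster_openAt_c_of_not_hConn {c : V} {ω : Config E} {v : V}
    (hvM : v ∉ G.cluster ω c) (hv : ¬ G.HConn ω c c v) : v ∉ G.cluster (G.openAt c ω) c := by
  intro hmem
  rcases (G.mem_cluster_openAt_c_iff c ω v).mp hmem with hcv | ⟨x, ⟨e, hj⟩, hxv⟩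
  · exact hvM hcv
  · have hxM : x ∉ G.cluster ω c := fun hxM => hvM ((hxM : G.Conn ω c x).trans hxv)
    have h1 : G.HAdj ω c c x :=
      Or.inr (Or.inl ⟨⟨fun _ => hxM, fun _ => G.self_mem_cluster ω c⟩, e, hj⟩)
    have h2 : G.HAdj ω c x v := Or.inr (Or.inr ⟨hxM, hvM, hxv⟩)
    exact hv ((Relation.ReflTransGen.single h1).tail h2)

/-- An edge joining two vertices other than `c` is not at `c`. -/
theorem not_mem_edgesAt_c_of_joins {c u v : V} {e : E} (hj : G.Joins e u v) (hu : u ≠ c) (hv : v ≠ c) :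
    e ∉ G.edgesAt ({c} : Set V) := by
  intro hc
  simp only [edgesAt, Set.mem_setOf_eq, Set.mem_singleton_iff] at hc
  rcases hj with ⟨h1, h2⟩ | ⟨h1, h2⟩ <;> rcases hc with hc | hc
  · exact hu (h1 ▸ hc)
  · exact hv (h2 ▸ hc)
  · exact hv (h1 ▸ hc)
  · exact hu (h2 ▸ hc)

/-- **Transfer of an H-step** to `S ∪ E_c` when neither endpoint is H-reachable from `c`. -/
theorem hAdj_openAt_of_hAdj {c : V} {ω : Config E} {u v : V} (hu : ¬ G.HConn ω c c u)
    (hv : ¬ G.HConn ω c c v) (h : G.HAdj ω c u v) : G.HAdj (G.openAt c ω) c u v := by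
  have huc : u ≠ c := fun huc => hu (huc ▸ Relation.ReflTransGen.refl)
  have hvc : v ≠ c := fun hvc => hv (hvc ▸ Relation.ReflTransGen.refl)
  have hmono : ∀ w, w ∈ G.cluster ω c → w ∈ G.cluster (G.openAt c ω) c :=
    fun w hw => Conn.mono (G.le_openAt c ω) hw
  rcases h with ⟨huM, hvM, e, he, hj⟩ | ⟨hiff, e, hj⟩ | ⟨huM, hvM, hconn⟩
  · refine Or.inl ⟨hmono u huM, hmono v hvM, e, ?_, hj⟩
    rw [G.openAt_apply_of_notMem (G.not_mem_edgesAt_c_of_joins hj huc hvc)]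
    exact he
  · by_cases huM : u ∈ G.cluster ω c
    · have hvM : v ∉ G.cluster ω c := hiff.mp huM
      have hv' := G.not_mem_cluster_openAt_c_of_not_hConn hvM hv
      exact Or.inr (Or.inl ⟨⟨fun _ => hv', fun _ => hmono u huM⟩, e, hj⟩)
    · have hvM : v ∈ G.cluster ω c := by
        by_contra hvM
        exact huM (hiff.mpr hvM)
      have hu' := G.not_mem_cluster_openAt_c_of_not_hConn huM hu
      exact Or.inr (Or.inl ⟨⟨fun h' => absurd h' hu', fun h' => absurd (hmono v hvM) h'⟩, e, hj⟩)
  · exact Or.inr (Or.inr ⟨G.not_mem_cluster_openAt_c_of_not_hConn huM hu,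
      G.not_mem_cluster_openAt_c_of_not_hConn hvM hv, Conn.mono (G.le_openAt c ω) hconn⟩)

/-- **Transfer of an H-walk** from `a` (not H-reachable from `c`) to `S ∪ E_c`. -/
theorem hConn_openAt_of_hConn {c : V} {ω : Config E} {a b : V} (hca : ¬ G.HConn ω c c a)
    (h : G.HConn ω c a b) : G.HConn (G.openAt c ω) c a b := by
  unfold HConn at h ⊢
  induction h with
  | refl => exact Relation.ReflTransGen.refl
  | @tail x y hax hxy ih =>
    have hx : ¬ G.HConn ω c c x := fun hcx => hca (hcx.trans (G.hConn_symm hax))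
    have hy : ¬ G.HConn ω c c y := fun hcy =>
      hca ((hcy.tail (G.hAdj_symm hxy)).trans (G.hConn_symm hax))
    exact ih.tail (G.hAdj_openAt_of_hAdj hx hy hxy)

/-- **No H-step of `S ∪ E_c` leaves `c`**: every edge at `c` is open, every neighbour of `c` is in its
cluster. -/
theorem not_hAdj_openAt_c {c : V} {ω : Config E} (v : V) : ¬ G.HAdj (G.openAt c ω) c c v := by
  rintro (⟨_, _, e, he, hj⟩ | ⟨hiff, e, hj⟩ | ⟨hcM, _, _⟩)
  · rw [G.openAt_apply_of_mem (G.mem_edgesAt_c_of_joins hj)] at he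
    exact absurd he (by decide)
  · have hcM : c ∈ G.cluster (G.openAt c ω) c := G.self_mem_cluster _ c
    have hvM : v ∈ G.cluster (G.openAt c ω) c :=
      Conn.of_openAdj ⟨e, G.openAt_apply_of_mem (G.mem_edgesAt_c_of_joins hj), hj⟩
    exact hiff.mp hcM hvM
  · exact hcM (G.self_mem_cluster _ c)

/-- No H-walk of `S ∪ E_c` avoiding `X` leaves `c`. -/
theorem not_hConnAvoid_openAt_c {c : V} {ω : Config E} {X : Set V} {v : V} (hv : v ≠ c) :
    ¬ G.HConnAvoid (G.openAt c ω) c X c v := by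
  intro h
  unfold HConnAvoid at h
  rcases Relation.ReflTransGen.cases_head h with h1 | ⟨y, hcy, _⟩
  · exact hv h1.symm
  · exact G.not_hAdj_openAt_c y hcy.1

/-- For `S ∈ KL` the cluster of `a` is unchanged by opening the star at `c`. -/
theorem cluster_openAt_a_eq {S : Config E} {a b c : V} (h : G.KL S a b c) :
    G.cluster (G.openAt c S) a = G.cluster S a :=
  cluster_eq_of_agree fun _ he =>
    (G.openAt_apply_of_notMem (G.not_mem_edgesAt_c_of_mem_edgesAt_cluster_a h he)).symm

/-- For `S ∈ KL` the cluster of `b` is unchanged by opening the star at `c`. -/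
theorem cluster_openAt_b_eq {S : Config E} {a b c : V} (h : G.KL S a b c) :
    G.cluster (G.openAt c S) b = G.cluster S b :=
  cluster_eq_of_agree fun _ he =>
    (G.openAt_apply_of_notMem (G.not_mem_edgesAt_c_of_mem_edgesAt_cluster_b h he)).symm

/-- For `S ∈ KL`, `S ∪ E_c ∈ bot`. -/
theorem isBot_openAt {S : Config E} {a b c : V} (h : G.KL S a b c) : G.IsBot (G.openAt c S) a b c := by
  refine ⟨fun h' => h.1.1.1 ?_, fun h' => h.1.1.2.1 ?_, fun h' => h.1.1.2.2 ?_⟩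
  · have : b ∈ G.cluster (G.openAt c S) a := h'
    rw [G.cluster_openAt_a_eq h] at this
    exact this
  · have : c ∈ G.cluster (G.openAt c S) a := h'
    rw [G.cluster_openAt_a_eq h] at this
    exact this
  · have : c ∈ G.cluster (G.openAt c S) b := h'
    rw [G.cluster_openAt_b_eq h] at this
    exact this

/-- **LEMMA E** (mine-3 §4 / §11 S2): the residual is closed under opening the star at `c`:
`S ∈ KL → S ∪ E_c ∈ KL`. -/
theorem kl_openAt {S : Config E} {a b c : V} (h : G.KL S a b c) : G.KL (G.openAt c S) a b c := by
  have hbot := G.isBot_openAt h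
  have hac : a ≠ c := fun hac => h.1.1.2.1 (hac ▸ Conn.refl G S a)
  have hbc : b ≠ c := fun hbc => h.1.1.2.2 (hbc ▸ Conn.refl G S b)
  refine ⟨⟨hbot, ?_⟩, ?_, ?_⟩
  · rw [G.conn_kSwap_iff_hConn]
    exact G.hConn_openAt_of_hConn (G.not_hConn_c_a_of_kl h)
      ((G.conn_kSwap_iff_hConn S c a b).mp h.1.2)
  · rintro ⟨_, h1⟩
    rw [G.cellAC_kSwapSealed_iff hbot] at h1
    exact G.not_hConnAvoid_openAt_c hac h1
  · rintro ⟨_, h2⟩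
    rw [G.cellBC_kSwapSealed_iff hbot] at h2
    exact G.not_hConnAvoid_openAt_c hbc h2

end Residual

end MultiGraph

end PercRepro
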